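import Literature.Topology.FourManifolds.HomotopySpheresSignature
import Literature.Topology.FourManifolds.HCobordismProofs
import Literature.Topology.FourManifolds.HomotopySpheresStablyParallelizable
import Literature.Topology.FourManifolds.PontryaginThomCollapse
import Literature.Topology.FourManifolds.WhitneySphereEmbedding
import Literature.Topology.FourManifolds.HomotopySpheresGroupAssembly
import Literature.AlgebraicTopology.SingularHomology.OrientationCover
import Mathlib.Analysis.Convex.Contractible
import Mathlib.AlgebraicTopology.FundamentalGroupoid.SimplyConnected
import HarnessLib

/-!
# `bP₄ₘ` is finite cyclic (Kervaire–Milnor Cor. 7.6) from Thm. 7.5, Lemma 7.4 and §2: the "evident" proof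

Sibling proof file of `HomotopySpheresBP.lean`. It discharges conjunct (C) of the decomposition of
`Literature.Topology.FourManifolds.exists_commGroup_homotopySphereClass_isCyclic_seven`, the named fact
`Literature.Topology.FourManifolds.HomotopySphereClass.isCyclic_bP_four_mul` (Kervaire–Milnor, *Groups of homotopy spheres I*
(1963), Cor. 7.6: "`bP₄ₘ`, `m > 1`, is isomorphic to a subgroup of the cyclic group of order
`σₘ`. Hence `bP₄ₘ` is finite cyclic. The proof is evident."), **relative to** the printed
ingredients vendored in `HomotopySpheresSignature.lean`: Lemma 7.4
(`exists_mem_signatureSet_sphere_ne_zero`), Thm. 7.5 (`mk_eq_mk_iff_sigmaGen_dvd_sub`),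
additivity of `σ` over connected sums (`add_mem_signatureSet_of_isOrientedConnectedSum`, §2), the
comparisons "bounds parallelizable" vs "bounds oriented s-parallelizable"
(`nonempty_signatureSet_of_boundsParallelizable`, `boundsParallelizable_of_mem_signatureSet`,
Lemma 3.4), the existence of connected sums in `Θₙ` (`HomotopySphereClass.isMul_exists`,
Lemma 2.2 ff.) and a generator convention (`IsOrientableOver ℤ (𝔼 n) n`, from
`isOrientableOver_int_of_isOrientable` and `isOrientable_euclideanSpace`).

(The docstring of `isCyclic_bP_four_mul` in `HomotopySpheresBP.lean` predates
`HomotopySpheresSignature.lean` where it says that the primary clause of Cor. 7.6 is not vendored: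
it now is, as `mk_eq_mk_iff_sigmaGen_dvd_sub` with `signatureSet`/`sigmaGen`.)

## The evident proof (Kervaire–Milnor p. 530), as formalised

Fix `m > 1`, `n + 1 = 4m`, a commutative group structure on `Θₙ` compatible with `IsMul`, and a
generator convention `g`. By Lemma 7.4, `σₘ ≠ 0`. For `a ∈ bPₙ₊₁` choose a representative `Σ`
bounding a parallelizable manifold and `σ ∈ signatureSet Σ`; Thm. 7.5 says that
`a ↦ σ mod σₘ ∈ ℤ/σₘ` is well defined on `bPₙ₊₁` and injective. By §2-additivity and
`IsMul`-compatibility, `bPₙ₊₁` is closed under the product and the map is multiplicative (into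
`Multiplicative (ℤ/σₘ)`). Being in bijection with a subset of the finite `ℤ/σₘ`, `bPₙ₊₁` is finite;
a nonempty (Lemma 7.4: `Sⁿ ∈ bPₙ₊₁`) finite subset of a group closed under products is a
subgroup; an injective homomorphism into the cyclic group `ℤ/σₘ` makes it cyclic.

## Assembly down to the printed statements

`Literature.Topology.FourManifolds.exists_commGroup_homotopySphereClass_isCyclic_seven_of''` (at the end of this file, so
that `HCobordismProofs.lean` keeps its light imports) feeds `isCyclic_bP_four_mul_of` into the
assembly `Literature.Topology.FourManifolds.exists_commGroup_homotopySphereClass_isCyclic_seven_of'` (`HCobordismProofs.lean`):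
the target fact `Literature.Topology.FourManifolds.exists_commGroup_homotopySphereClass_isCyclic_seven` (`Θ₇` is a cyclic
group under connected sum) from named facts of the tree only — Kervaire–Milnor Thm. 1.1
(`Literature.Topology.FourManifolds.exists_commGroup_homotopySphereClass`), Thm. 3.1 (`HomotopySphere.isStablyParallelizable`),
§4 for `n = 7` (`HomotopySphere.boundsParallelizable_of_isStablyParallelizable_seven`), Lemma 7.4,
Thm. 7.5, §2-additivity and the two Lemma 3.4 comparisons (this file's inputs),
`HomotopySphereClass.isMul_exists` and `isOrientableOver_int_of_isOrientable (𝔼 k)`.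

`Literature.Topology.FourManifolds.exists_commGroup_homotopySphereClass_isCyclic_seven_of'''` refines `…_of''` by one
layer under Thm. 3.1: the leaf `HomotopySphere.isStablyParallelizable` (all `n`) is replaced by
the two leaves of `HomotopySpheresStablyParallelizable.lean` at `n = 7` —
`HomotopySphere.hasStableTangentFramingAlong_compl_singleton` (`o₇` is the only obstruction,
p. 508) and `Bott1959_sphereMapsToStableFramesExtend_six` (`π₆(SO(8)) = 0`, Bott) — through the
proved clutching theorem (`HomotopySphere.boundsParallelizable_seven_of'`).
`Literature.Topology.FourManifolds.exists_commGroup_homotopySphereClass_isCyclic_seven_of''''` refines moreover the §4 leaf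
`HomotopySphere.boundsParallelizable_of_isStablyParallelizable_seven` into its three printed
ingredients (`PontryaginThomCollapse.lean`): an embedding into `S⁷⁺ᵏ` with a normal framing
(p. 510 with Lemma 3.3; the tube then comes from the tree's tubular neighbourhood theorem,
`FramedTubularNbhd.lean`), Lemma 4.2 (null-homotopic Pontryagin–Thom collapse ⇒ bounds a
parallelizable manifold) and `0 ∈ p(Σ)` for homotopy `7`-spheres (Lemma 4.5 with
`coker J₇ = 0`, table p. 512).
`Literature.Topology.FourManifolds.exists_commGroup_homotopySphereClass_isCyclic_seven_of_leaves` finally replaces the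
embedding-with-normal-framing fact by Kervaire–Milnor's Lemma 3.3 alone
(`WhitneySphereEmbedding.lean`: Whitney's embedding into a round sphere is proved from Mathlib's
Whitney embedding theorem), listing the current leaves of the decomposition.

`Literature.Topology.FourManifolds.exists_commGroup_homotopySphereClass_isCyclic_seven_of_leaves'` discharges the two
shared inputs of `…_of_leaves`: the generator convention `IsOrientableOver ℤ (𝔼 k) k` is now a
theorem (`isOrientableOver_int_euclideanSpace`: `ℝᵏ` is contractible, hence simply connected, and
simply connected manifolds are `ℤ`-orientable — Hatcher Prop. 3.25, proved in the tree as
`Literature.AlgebraicTopology.SingularHomology.isOrientableOver_of_simplyConnectedSpace`, `OrientationCover.lean`), and the existence of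
products in `Θₖ` (`HomotopySphereClass.isMul_exists`) follows from the tree theorem
`exists_isOrientedConnectedSum_holds` (existence of oriented connected sums,
`OrientedConnectedSumExistence.lean`) and Kervaire–Milnor's remark that the sum of two homotopy
spheres is a homotopy sphere (`HomotopySphere.nonempty_homotopyEquiv_sphere_of_isConnectedSum`,
§2 p. 505 — itself reduced in `HomotopySpheresSumProofs.lean`), which is already a leaf under
Thm. 1.1 (`exists_commGroup_homotopySphereClass_of_manifoldFacts`, `HomotopySpheresGroupProofs.lean`).
Finally `Literature.Topology.FourManifolds.exists_commGroup_homotopySphereClass_isCyclic_seven_of_manifoldFacts` also unfolds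
the leaf Thm. 1.1: only the group `Θ₇` is needed, and the class-level group laws in dimension `7`
(`HomotopySphereClass.GroupLawFacts 7`) have been reduced in the tree
(`HomotopySphereClass.groupLawFacts_of_remainingFacts`, `HomotopySpheresGroupAssembly.lean`) to
five named facts — sums of homotopy spheres are homotopy spheres (p. 505), Palais–Cerf uniqueness
and associativity of `#` (Lemma 2.1), `Σ # (-Σ) ∼ₕ Sⁿ` (Lemmas 2.3–2.4) and the h-cobordism
theorem (Smale) — the group structure itself being pure algebra
(`HomotopySphereClass.GroupLawFacts.exists_commGroup`, proved); through the dimension-`7` assembly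
`Literature.Topology.FourManifolds.exists_commGroup_homotopySphereClass_isCyclic_seven_of_commGroup` the target `Θ₇` cyclic
is thus one theorem over fifteen named facts of the tree, all at the level of the printed
statements of Kervaire–Milnor 1963 and of its classical inputs (no appeal to the smooth Poincaré
conjecture in low dimensions, which enters Thm. 1.1 only for `Θₙ`, `n ≤ 3`).
-/

open scoped Manifold ContDiff Topology
open Set Function

noncomputable section

namespace Literature.Topology.FourManifolds

/-- Local notation: `𝔼 n` is the model Euclidean space `EuclideanSpace ℝ (Fin n)`. -/
local notation "𝔼 " n:arg => EuclideanSpace ℝ (Fin n)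

/-- Local notation: `𝕊 n` is the unit sphere in `EuclideanSpace ℝ (Fin (n + 1))`. -/
local notation "𝕊 " n:arg => (Metric.sphere (0 : EuclideanSpace ℝ (Fin (n + 1))) 1)

namespace HomotopySphereClass

open HomotopySphere

/-- A nonempty finite subset of a group which is closed under multiplication is (the carrier of)
a subgroup: left translation by `a ∈ S` is an injection `S → S`, hence a bijection, so `1 ∈ S`
and `a⁻¹ ∈ S`. [folklore] -/
theorem exists_subgroup_coe_eq_of_finite_of_mul_mem {G : Type*} [Group G] {S : Set G}
    (hfin : S.Finite) (hne : S.Nonempty) (hmul : ∀ a ∈ S, ∀ b ∈ S, a * b ∈ S) :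
    ∃ H : Subgroup G, (H : Set G) = S := by
  haveI : Finite S := hfin.to_subtype
  -- left translation by `a ∈ S` is a bijection of `S`
  have hsurj : ∀ a ∈ S, ∀ c ∈ S, ∃ b ∈ S, a * b = c := by
    intro a ha c hc
    let F : S → S := fun b => ⟨a * b, hmul a ha b b.2⟩
    have hF : Injective F := fun b b' h => Subtype.ext (mul_left_cancel (Subtype.ext_iff.1 h))
    obtain ⟨b, hb⟩ := Finite.surjective_of_injective hF ⟨c, hc⟩
    exact ⟨b, b.2, Subtype.ext_iff.1 hb⟩
  obtain ⟨a₀, ha₀⟩ := hne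
  have hone : (1 : G) ∈ S := by
    obtain ⟨b, hb, hab⟩ := hsurj a₀ ha₀ a₀ ha₀
    have : b = 1 := mul_left_cancel (hab.trans (mul_one a₀).symm)
    exact this ▸ hb
  have hinv : ∀ a ∈ S, a⁻¹ ∈ S := by
    intro a ha
    obtain ⟨b, hb, hab⟩ := hsurj a ha 1 hone
    have : a⁻¹ = b := inv_eq_of_mul_eq_one_right hab
    exact this ▸ hb
  exact ⟨⟨⟨⟨S, fun ha hb => hmul _ ha _ hb⟩, hone⟩, fun ha => hinv _ ha⟩, rfl⟩

/-- **Kervaire–Milnor Cor. 7.6 from its printed ingredients.** Conjunct (C)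
`HomotopySphereClass.isCyclic_bP_four_mul` (`bP₄ₘ`, `m > 1`, is a finite cyclic subgroup of `Θ₄ₘ₋₁`
for every `IsMul`-compatible group structure) follows from Lemma 7.4, Thm. 7.5, the additivity of
signatures over connected sums (§2), Lemma 3.4 (both comparison facts), the existence of connected
sums in `Θₙ` and a generator convention for `Hₙ(ℝⁿ | pt; ℤ)`. Kervaire–Milnor 1963, p. 530:
"The proof is evident." [cite: KervaireMilnorAnnals1963, Cor. 7.6 (p. 530), from Thm. 7.5 and Lemma 7.4] -/
theorem isCyclic_bP_four_mul_of
    (h74 : exists_mem_signatureSet_sphere_ne_zero)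
    (h75 : mk_eq_mk_iff_sigmaGen_dvd_sub)
    (hadd : add_mem_signatureSet_of_isOrientedConnectedSum)
    (hne : nonempty_signatureSet_of_boundsParallelizable)
    (hbd : boundsParallelizable_of_mem_signatureSet)
    (hmul : ∀ k : ℕ, isMul_exists (n := k))
    (hg : ∀ k : ℕ, Literature.AlgebraicTopology.SingularHomology.IsOrientableOver ℤ (𝔼 k) k) :
    isCyclic_bP_four_mul := by
  intro m n hm h inst hcompat
  classical
  -- a generator convention for `Hₙ(ℝⁿ | pt; ℤ)`
  obtain ⟨g⟩ := hg n
  -- Lemma 7.4: `σₘ ≠ 0`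
  obtain ⟨o₀, σ₀, hσ₀, hσ₀0⟩ := h74 n m h (by omega) g
  have hk : sigmaGen g m h ≠ 0 := sigmaGen_ne_zero (mem_sphereSignatureSubgroup hσ₀) hσ₀0
  haveI : NeZero (sigmaGen g m h) := ⟨hk⟩
  -- abbreviations
  set k : ℕ := sigmaGen g m h with hk_def
  have hbP : ∀ {a : HomotopySphereClass n}, a ∈ bP n →
      ∃ S : HomotopySphere n, mk S = a ∧ S.BoundsParallelizable := fun ha => ha
  -- the value `σ(M) mod σₘ` of a class in `bP`, through chosen representatives
  let val : HomotopySphereClass n → ZMod k := fun a =>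
    if ha : a ∈ bP n then
      (((hne n m h g (hbP ha).choose (hbP ha).choose_spec.2).some : ℤ) : ZMod k)
    else 0
  -- Thm. 7.5 (⇒): the value does not depend on the choices
  have hval : ∀ (S : HomotopySphere n) (σ : ℤ), σ ∈ signatureSet g m h S →
      val (mk S) = (σ : ZMod k) := by
    intro S σ hσ
    have ha : mk S ∈ bP n := mk_mem_bP (hbd n m h g S σ hσ)
    simp only [val, dif_pos ha]
    have hS' := (hbP ha).choose_spec
    have hσ' := (hne n m h g (hbP ha).choose (hbP ha).choose_spec.2).some_mem
    have hdvd : (k : ℤ) ∣ _ - σ := (h75 n m h hm g _ S _ σ hσ' hσ).1 hS'.1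
    exact ((ZMod.intCast_eq_intCast_iff_dvd_sub σ _ k).2 hdvd).symm
  -- Thm. 7.5 (⇐): injectivity on `bP`
  have hinj : ∀ a ∈ bP n, ∀ b ∈ bP n, val a = val b → a = b := by
    rintro a ⟨S, rfl, hS⟩ b ⟨T, rfl, hT⟩ hab
    obtain ⟨σ, hσ⟩ := hne n m h g S hS
    obtain ⟨τ, hτ⟩ := hne n m h g T hT
    rw [hval S σ hσ, hval T τ hτ, ZMod.intCast_eq_intCast_iff_dvd_sub] at hab
    exact (h75 n m h hm g S T σ τ hσ hτ).2 ((dvd_sub_comm).1 hab)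
  -- §2: `bP` is closed under the product and `val` is multiplicative
  have hmulmem : ∀ a ∈ bP n, ∀ b ∈ bP n, a * b ∈ bP n ∧ val (a * b) = val a + val b := by
    intro a ha b hb
    obtain ⟨c, hc⟩ := hmul n (by omega) a b
    have habc : a * b = c := hcompat a b c hc
    obtain ⟨S, T, U, rfl, rfl, rfl, hsum⟩ := hc
    obtain ⟨σ, hσ⟩ := hne n m h g S (mk_mem_bP_iff.1 ha)
    obtain ⟨τ, hτ⟩ := hne n m h g T (mk_mem_bP_iff.1 hb)
    have hU : σ + τ ∈ signatureSet g m h U := hadd n m h g S T U hsum σ hσ τ hτ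
    refine ⟨habc ▸ mk_mem_bP (hbd n m h g U _ hU), ?_⟩
    rw [habc, hval U _ hU, hval S σ hσ, hval T τ hτ, Int.cast_add]
  -- `bP` is finite (it injects into `ℤ/σₘ`) and nonempty (`Sⁿ ∈ bP`, from Lemma 7.4)
  have hfin : (bP n).Finite :=
    Set.Finite.of_finite_image (Set.toFinite (val '' bP n)) fun a ha b hb => hinj a ha b hb
  have h1 : mk ⟨𝕊 n, o₀, ⟨.refl _⟩⟩ ∈ bP n := mk_mem_bP (hbd n m h g _ σ₀ hσ₀)
  -- hence a subgroup
  obtain ⟨H, hH⟩ := exists_subgroup_coe_eq_of_finite_of_mul_mem hfin ⟨_, h1⟩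
    fun a ha b hb => (hmulmem a ha b hb).1
  have hmemH : ∀ {a}, a ∈ H ↔ a ∈ bP n := fun {a} => by rw [← SetLike.mem_coe, hH]
  -- the injective homomorphism `bP → Multiplicative (ℤ/σₘ)`
  have hval1 : val 1 = 0 := by
    have := (hmulmem 1 (hmemH.1 H.one_mem) 1 (hmemH.1 H.one_mem)).2
    rw [mul_one] at this
    simpa using this
  let φ : H →* Multiplicative (ZMod k) :=
    { toFun := fun x => Multiplicative.ofAdd (val x)
      map_one' := by simp [hval1]
      map_mul' := fun x y => by
        rw [← ofAdd_add, Subgroup.coe_mul, (hmulmem x (hmemH.1 x.2) y (hmemH.1 y.2)).2] }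
  have hφ : Injective φ := fun x y hxy =>
    Subtype.ext (hinj x (hmemH.1 x.2) y (hmemH.1 y.2) (by simpa [φ] using hxy))
  -- conclusion
  refine ⟨H, hH, ?_, ?_⟩
  · exact isCyclic_of_surjective (MonoidHom.ofInjective hφ).symm
      (MonoidHom.ofInjective hφ).symm.surjective
  · have : Finite ↥(bP n) := hfin.to_subtype
    exact Finite.of_injective (fun x : H => (⟨x, hmemH.1 x.2⟩ : ↥(bP n)))
      fun x y hxy => Subtype.ext (congrArg Subtype.val hxy :)

end HomotopySphereClass

/-! ### Assembly down to the printed statements of Kervaire–Milnor -/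

/-- **Assembly down to the printed statements of Kervaire–Milnor §7.** The target from: the group
structure on `Θₙ` (Thm. 1.1, `Literature.Topology.FourManifolds.exists_commGroup_homotopySphereClass`), Thm. 3.1
(`Literature.Topology.FourManifolds.HomotopySphere.isStablyParallelizable`), §4 for `n = 7`
(`Literature.Topology.FourManifolds.HomotopySphere.boundsParallelizable_of_isStablyParallelizable_seven`), and — replacing
Cor. 7.6 by its "evident" proof (`Literature.Topology.FourManifolds.HomotopySphereClass.isCyclic_bP_four_mul_of`,
`HomotopySpheresBPProofs.lean`) — Lemma 7.4, Thm. 7.5, the additivity of signatures over connected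
sums (§2), the two comparison facts around Lemma 3.4, the existence of connected sums in `Θₙ`
(Lemma 2.2 ff., `HomotopySphereClass.isMul_exists`) and a generator convention for
`Hₙ(ℝⁿ | pt; ℤ)` (`IsOrientableOver ℤ (𝔼 n) n`, from the bridge fact
`Literature.Topology.FourManifolds.isOrientableOver_int_of_isOrientable` applied to `𝔼 n`, which is smoothly orientable,
`Literature.Topology.FourManifolds.isOrientable_euclideanSpace`). Every hypothesis is now a named fact of the tree (or a family of
instances of one). [cite: KervaireMilnorAnnals1963, Thm. 1.1, Thm. 3.1, §4 (p. 512), Lemma 7.4, Thm. 7.5, Cor. 7.6] -/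
theorem exists_commGroup_homotopySphereClass_isCyclic_seven_of''
    (hA : exists_commGroup_homotopySphereClass)
    (hBa : HomotopySphere.isStablyParallelizable)
    (hBb : HomotopySphere.boundsParallelizable_of_isStablyParallelizable_seven)
    (h74 : HomotopySphere.exists_mem_signatureSet_sphere_ne_zero)
    (h75 : HomotopySphere.mk_eq_mk_iff_sigmaGen_dvd_sub)
    (hadd : HomotopySphere.add_mem_signatureSet_of_isOrientedConnectedSum)
    (hne : HomotopySphere.nonempty_signatureSet_of_boundsParallelizable)
    (hbd : HomotopySphere.boundsParallelizable_of_mem_signatureSet)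
    (hmul : ∀ k : ℕ, HomotopySphereClass.isMul_exists (n := k))
    (hg : ∀ k : ℕ, isOrientableOver_int_of_isOrientable (n := k) (EuclideanSpace ℝ (Fin k))) :
    FourManifolds.exists_commGroup_homotopySphereClass_isCyclic_seven :=
  FourManifolds.exists_commGroup_homotopySphereClass_isCyclic_seven_of' hA hBa hBb
    (HomotopySphereClass.isCyclic_bP_four_mul_of h74 h75 hadd hne hbd hmul
      fun k => hg k (isOrientable_euclideanSpace k))

/-- **`Θ₇` is cyclic, from named tree facts with Thm. 3.1 refined to its `n = 7` leaves.**
As `SPC4.exists_commGroup_homotopySphereClass_isCyclic_seven_of''`, but with Kervaire–Milnor's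
Thm. 3.1 (`HomotopySphere.isStablyParallelizable`, every homotopy sphere is s-parallelizable)
replaced by the two finer named facts from which `HomotopySpheresStablyParallelizable.lean`
proves it for `n = 7` (Case 1 of the printed proof, p. 508): the stable tangent bundle of a
homotopy sphere is trivial off a point
(`HomotopySphere.hasStableTangentFramingAlong_compl_singleton`) and `π₆(SO(8)) = 0` in extension
form (`Bott1959_sphereMapsToStableFramesExtend_six`). The remaining inputs are unchanged:
Thm. 1.1 (`exists_commGroup_homotopySphereClass`), §4 at `n = 7`
(`HomotopySphere.boundsParallelizable_of_isStablyParallelizable_seven`), Lemma 7.4, Thm. 7.5,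
§2-additivity, the two Lemma 3.4 comparisons, `HomotopySphereClass.isMul_exists` and
`isOrientableOver_int_of_isOrientable (𝔼 k)`. [cite: KervaireMilnorAnnals1963, Thm. 1.1, Thm. 3.1 (proof p. 508, Case 1), §4 (table p. 512), Lemma 7.4, Thm. 7.5, Cor. 7.6 (p. 530)] [cite: Bott1959, Theorem (π₆(O) = 0)] -/
theorem exists_commGroup_homotopySphereClass_isCyclic_seven_of'''
    (hA : exists_commGroup_homotopySphereClass)
    (hAP : HomotopySphere.hasStableTangentFramingAlong_compl_singleton)
    (hBott : Bott1959_sphereMapsToStableFramesExtend_six)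
    (hBb : HomotopySphere.boundsParallelizable_of_isStablyParallelizable_seven)
    (h74 : HomotopySphere.exists_mem_signatureSet_sphere_ne_zero)
    (h75 : HomotopySphere.mk_eq_mk_iff_sigmaGen_dvd_sub)
    (hadd : HomotopySphere.add_mem_signatureSet_of_isOrientedConnectedSum)
    (hne : HomotopySphere.nonempty_signatureSet_of_boundsParallelizable)
    (hbd : HomotopySphere.boundsParallelizable_of_mem_signatureSet)
    (hmul : ∀ k : ℕ, HomotopySphereClass.isMul_exists (n := k))
    (hg : ∀ k : ℕ, isOrientableOver_int_of_isOrientable (n := k) (EuclideanSpace ℝ (Fin k))) :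
    FourManifolds.exists_commGroup_homotopySphereClass_isCyclic_seven :=
  FourManifolds.exists_commGroup_homotopySphereClass_isCyclic_seven_of hA
    (HomotopySphere.boundsParallelizable_seven_of' hBott hAP hBb)
    (HomotopySphereClass.isCyclic_bP_four_mul_of h74 h75 hadd hne hbd hmul
      fun k => hg k (isOrientable_euclideanSpace k))

/-- **`Θ₇` is cyclic, from named tree facts with both Thm. 3.1 and §4 refined to their `n = 7`
leaves.** As `SPC4.exists_commGroup_homotopySphereClass_isCyclic_seven_of'''`, with moreover the
§4 leaf `HomotopySphere.boundsParallelizable_of_isStablyParallelizable_seven` replaced by its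
printed ingredients from `PontryaginThomCollapse.lean`: (a) an s-parallelizable closed manifold
embeds in `Sⁿ⁺ᵏ`, `k > n + 1`, with a normal framing (p. 510 with Lemma 3.3;
`exists_isSmoothEmbedding_isNormalFraming_of_isStablyParallelizable`; the trivialised tube is
then the tree's tubular neighbourhood theorem, `FramedTubularNbhd.lean`), (b) Lemma 4.2,
Pontryagin–Thom direction (`boundsParallelizable_of_collapseNullHomotopic`), (c) `0 ∈ p(Σ)` for
homotopy `7`-spheres (Lemma 4.5 with `coker J₇ = 0`, table p. 512;
`HomotopySphere.exists_collapseNullHomotopic_seven`), glued by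
`HomotopySphere.boundsParallelizable_of_isStablyParallelizable_seven_of`. The target
`Literature.Topology.FourManifolds.exists_commGroup_homotopySphereClass_isCyclic_seven` thus rests on the named facts:
Thm. 1.1; `o₇` is the only obstruction and `π₆(SO(8)) = 0` (for Thm. 3.1 at `n = 7`); (a), (b),
(c) (for §4 at `n = 7`, with the tree-proved tubular neighbourhood theorem); Lemma 7.4,
Thm. 7.5, §2-additivity and the two Lemma 3.4 comparisons (for Cor. 7.6);
`HomotopySphereClass.isMul_exists`; `isOrientableOver_int_of_isOrientable (𝔼 k)`.
[cite: KervaireMilnorAnnals1963, Thm. 1.1, Thm. 3.1 (p. 508), §4 (pp. 510–512: Lemma 4.2, Lemma 4.5, table), Lemma 7.4, Thm. 7.5, Cor. 7.6 (p. 530)] [cite: Bott1959, Theorem (π₆(O) = 0)] -/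
theorem exists_commGroup_homotopySphereClass_isCyclic_seven_of''''
    (hA : exists_commGroup_homotopySphereClass)
    (hAP : HomotopySphere.hasStableTangentFramingAlong_compl_singleton)
    (hBott : Bott1959_sphereMapsToStableFramesExtend_six)
    (ha : exists_isSmoothEmbedding_isNormalFraming_of_isStablyParallelizable)
    (hb : boundsParallelizable_of_collapseNullHomotopic)
    (hc : HomotopySphere.exists_collapseNullHomotopic_seven)
    (h74 : HomotopySphere.exists_mem_signatureSet_sphere_ne_zero)
    (h75 : HomotopySphere.mk_eq_mk_iff_sigmaGen_dvd_sub)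
    (hadd : HomotopySphere.add_mem_signatureSet_of_isOrientedConnectedSum)
    (hne : HomotopySphere.nonempty_signatureSet_of_boundsParallelizable)
    (hbd : HomotopySphere.boundsParallelizable_of_mem_signatureSet)
    (hmul : ∀ k : ℕ, HomotopySphereClass.isMul_exists (n := k))
    (hg : ∀ k : ℕ, isOrientableOver_int_of_isOrientable (n := k) (EuclideanSpace ℝ (Fin k))) :
    FourManifolds.exists_commGroup_homotopySphereClass_isCyclic_seven :=
  FourManifolds.exists_commGroup_homotopySphereClass_isCyclic_seven_of''' hA hAP hBott
    (HomotopySphere.boundsParallelizable_of_isStablyParallelizable_seven_of ha hb hc)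
    h74 h75 hadd hne hbd hmul hg

/-- **`Θ₇` is cyclic, from the current leaves of the decomposition.** As
`SPC4.exists_commGroup_homotopySphereClass_isCyclic_seven_of''''`, with the embedding fact of
p. 510 replaced by Kervaire–Milnor's Lemma 3.3 (`exists_isNormalFraming_of_isStablyParallelizable`;
Whitney's embedding into `S⁷⁺ᵏ` and the tubular neighbourhood theorem are proved in the tree,
`WhitneySphereEmbedding.lean`, `FramedTubularNbhd.lean`). The target
`Literature.Topology.FourManifolds.exists_commGroup_homotopySphereClass_isCyclic_seven` — `Θ₇` is a cyclic group under
connected sum (Kervaire–Milnor 1963 with Smale) — thus follows from the named facts: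
Thm. 1.1 (`exists_commGroup_homotopySphereClass`); for Thm. 3.1 at `n = 7`: `o₇` is the only
obstruction (`HomotopySphere.hasStableTangentFramingAlong_compl_singleton`) and `π₆(SO(8)) = 0`
(`Bott1959_sphereMapsToStableFramesExtend_six`); for §4 at `n = 7`: Lemma 3.3, Lemma 4.2
(`boundsParallelizable_of_collapseNullHomotopic`) and `0 ∈ p(Σ⁷)`
(`HomotopySphere.exists_collapseNullHomotopic_seven`, Lemma 4.5 with `coker J₇ = 0`); for
Cor. 7.6: Lemma 7.4, Thm. 7.5, §2-additivity and the two Lemma 3.4 comparisons; and the shared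
facts `HomotopySphereClass.isMul_exists`, `isOrientableOver_int_of_isOrientable (𝔼 k)`.
[cite: KervaireMilnorAnnals1963, Thm. 1.1, Thm. 3.1 (p. 508), Lemma 3.3 (p. 509), §4 (pp. 510–512), Lemma 7.4, Thm. 7.5, Cor. 7.6 (p. 530)] [cite: Bott1959, Theorem (π₆(O) = 0)] -/
theorem exists_commGroup_homotopySphereClass_isCyclic_seven_of_leaves
    (hA : exists_commGroup_homotopySphereClass)
    (hAP : HomotopySphere.hasStableTangentFramingAlong_compl_singleton)
    (hBott : Bott1959_sphereMapsToStableFramesExtend_six)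
    (h33 : exists_isNormalFraming_of_isStablyParallelizable)
    (h42 : boundsParallelizable_of_collapseNullHomotopic)
    (hc : HomotopySphere.exists_collapseNullHomotopic_seven)
    (h74 : HomotopySphere.exists_mem_signatureSet_sphere_ne_zero)
    (h75 : HomotopySphere.mk_eq_mk_iff_sigmaGen_dvd_sub)
    (hadd : HomotopySphere.add_mem_signatureSet_of_isOrientedConnectedSum)
    (hne : HomotopySphere.nonempty_signatureSet_of_boundsParallelizable)
    (hbd : HomotopySphere.boundsParallelizable_of_mem_signatureSet)
    (hmul : ∀ k : ℕ, HomotopySphereClass.isMul_exists (n := k))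
    (hg : ∀ k : ℕ, isOrientableOver_int_of_isOrientable (n := k) (EuclideanSpace ℝ (Fin k))) :
    FourManifolds.exists_commGroup_homotopySphereClass_isCyclic_seven :=
  FourManifolds.exists_commGroup_homotopySphereClass_isCyclic_seven_of''' hA hAP hBott
    (HomotopySphere.boundsParallelizable_of_isStablyParallelizable_seven_of' h33 h42 hc)
    h74 h75 hadd hne hbd hmul hg

/-! ### Discharging the shared inputs: `ℝᵏ` is `ℤ`-orientable; products in `Θₖ` exist -/

/-- **`ℝᵏ` is `ℤ`-orientable** (homologically, `Literature.IsOrientableOver ℤ (𝔼 k) k`): `ℝᵏ` is a real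
topological vector space, hence contractible (Mathlib's `RealTopologicalVectorSpace.contractibleSpace`)
and simply connected (`SimplyConnectedSpace.ofContractible`), and a simply connected topological
manifold is `R`-orientable for every `R` (Hatcher, *Algebraic Topology* (2002), §3.3, Prop. 3.25;
tree theorem `Literature.AlgebraicTopology.SingularHomology.isOrientableOver_of_simplyConnectedSpace`, `OrientationCover.lean`). This is the
generator convention `g : HomologicalOrientation ℤ (𝔼 n) n` of `HomotopySpheresSignature.lean`.
[cite: HatcherAT2002, §3.3 Prop. 3.25] -/
theorem isOrientableOver_int_euclideanSpace (k : ℕ) :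
    Literature.AlgebraicTopology.SingularHomology.IsOrientableOver ℤ (EuclideanSpace ℝ (Fin k)) k :=
  Literature.AlgebraicTopology.SingularHomology.isOrientableOver_of_simplyConnectedSpace ℤ (EuclideanSpace ℝ (Fin k))

/-- The instance at `X = ℝᵏ` of the bridge fact `Literature.Topology.FourManifolds.isOrientableOver_int_of_isOrientable`
(`IntersectionLattice.lean`: smoothly orientable ⇒ `ℤ`-orientable; Bredon VI.7.15,
Milnor–Stasheff App. A) holds outright, its conclusion being the theorem
`isOrientableOver_int_euclideanSpace` (Hatcher 2002, Prop. 3.25). [cite: HatcherAT2002, §3.3 Prop. 3.25] -/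
theorem isOrientableOver_int_of_isOrientable_euclideanSpace (k : ℕ) :
    isOrientableOver_int_of_isOrientable (n := k) (EuclideanSpace ℝ (Fin k)) :=
  fun _ => isOrientableOver_int_euclideanSpace k

/-- **Products exist in `Θₖ`** (`HomotopySphereClass.isMul_exists`, Kervaire–Milnor 1963, §2,
p. 505 and Lemma 2.2 ff.) from the single named fact that the connected sum of two homotopy
spheres is a homotopy sphere (`HomotopySphere.nonempty_homotopyEquiv_sphere_of_isConnectedSum`,
p. 505: "It is clear that the sum of two homotopy `n`-spheres is a homotopy `n`-sphere"): the
existence of oriented connected sums is the tree theorem `exists_isOrientedConnectedSum_holds`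
(`OrientedConnectedSumExistence.lean`), fed into `HomotopySphereClass.isMul_exists_of`
(`HomotopySpheresGroup.lean`). [cite: KervaireMilnorAnnals1963, §2 p. 505] -/
theorem HomotopySphereClass.isMul_exists_of_nonempty_homotopyEquiv_sphere
    (hK1 : HomotopySphere.nonempty_homotopyEquiv_sphere_of_isConnectedSum) (k : ℕ) :
    HomotopySphereClass.isMul_exists (n := k) :=
  HomotopySphereClass.isMul_exists_of exists_isOrientedConnectedSum_holds hK1

/-- **`Θ₇` is cyclic, from the current leaves of the decomposition (second list).** As
`SPC4.exists_commGroup_homotopySphereClass_isCyclic_seven_of_leaves`, with its two shared inputs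
discharged: the generator convention `IsOrientableOver ℤ (𝔼 k) k` is the theorem
`isOrientableOver_int_euclideanSpace` (Hatcher Prop. 3.25 for the contractible `ℝᵏ`,
`OrientationCover.lean`), and `HomotopySphereClass.isMul_exists` is replaced by the finer named
fact `HomotopySphere.nonempty_homotopyEquiv_sphere_of_isConnectedSum` (Kervaire–Milnor §2,
p. 505; existence of oriented connected sums being the tree theorem
`exists_isOrientedConnectedSum_holds`), a leaf it shares with the decomposition of Thm. 1.1
(`exists_commGroup_homotopySphereClass_of_manifoldFacts`). The target
`Literature.Topology.FourManifolds.exists_commGroup_homotopySphereClass_isCyclic_seven` — `Θ₇` is a cyclic group under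
connected sum (Kervaire–Milnor 1963 with Smale) — thus follows from the named facts: Thm. 1.1
(`exists_commGroup_homotopySphereClass`); p. 505 (sums of homotopy spheres); for Thm. 3.1 at
`n = 7`: `o₇` is the only obstruction (`HomotopySphere.hasStableTangentFramingAlong_compl_singleton`)
and `π₆(SO(8)) = 0` (`Bott1959_sphereMapsToStableFramesExtend_six`); for §4 at `n = 7`: Lemma 3.3
(`exists_isNormalFraming_of_isStablyParallelizable`), Lemma 4.2
(`boundsParallelizable_of_collapseNullHomotopic`) and `0 ∈ p(Σ⁷)`
(`HomotopySphere.exists_collapseNullHomotopic_seven`, Lemma 4.5 with `coker J₇ = 0`); for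
Cor. 7.6: Lemma 7.4, Thm. 7.5, §2-additivity of `σ` and the two Lemma 3.4 comparisons.
[cite: KervaireMilnorAnnals1963, Thm. 1.1, §2 (p. 505), Thm. 3.1 (p. 508), Lemma 3.3 (p. 509), §4 (pp. 510–512), Lemma 7.4, Thm. 7.5, Cor. 7.6 (p. 530)] [cite: Bott1959, Theorem (π₆(O) = 0)] [cite: HatcherAT2002, §3.3 Prop. 3.25] -/
theorem exists_commGroup_homotopySphereClass_isCyclic_seven_of_leaves'
    (hA : exists_commGroup_homotopySphereClass)
    (hK1 : HomotopySphere.nonempty_homotopyEquiv_sphere_of_isConnectedSum)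
    (hAP : HomotopySphere.hasStableTangentFramingAlong_compl_singleton)
    (hBott : Bott1959_sphereMapsToStableFramesExtend_six)
    (h33 : exists_isNormalFraming_of_isStablyParallelizable)
    (h42 : boundsParallelizable_of_collapseNullHomotopic)
    (hc : HomotopySphere.exists_collapseNullHomotopic_seven)
    (h74 : HomotopySphere.exists_mem_signatureSet_sphere_ne_zero)
    (h75 : HomotopySphere.mk_eq_mk_iff_sigmaGen_dvd_sub)
    (hadd : HomotopySphere.add_mem_signatureSet_of_isOrientedConnectedSum)
    (hne : HomotopySphere.nonempty_signatureSet_of_boundsParallelizable)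
    (hbd : HomotopySphere.boundsParallelizable_of_mem_signatureSet) :
    FourManifolds.exists_commGroup_homotopySphereClass_isCyclic_seven :=
  FourManifolds.exists_commGroup_homotopySphereClass_isCyclic_seven_of_leaves hA hAP hBott h33 h42 hc
    h74 h75 hadd hne hbd (HomotopySphereClass.isMul_exists_of_nonempty_homotopyEquiv_sphere hK1)
    isOrientableOver_int_of_isOrientable_euclideanSpace

/-- **The dimension-`7` assembly.** As `SPC4.exists_commGroup_homotopySphereClass_isCyclic_seven_of`
(`HCobordismProofs.lean`), but consuming only a commutative group structure on `Θ₇` compatible with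
the connected sum (instead of Kervaire–Milnor's Thm. 1.1 for all `Θₙ`, `n ≠ 4`): with (B)
`Θ₇ = bP₈` (`HomotopySphere.boundsParallelizable_seven`, §4 with the table p. 512) and (C) "`bP₄ₘ`
is finite cyclic" (`HomotopySphereClass.isCyclic_bP_four_mul`, Cor. 7.6) the cyclic subgroup
`bP₈` is all of `Θ₇`. [cite: KervaireMilnorAnnals1963, §4 p. 512 (table) and Cor. 7.6] -/
theorem exists_commGroup_homotopySphereClass_isCyclic_seven_of_commGroup
    (hA7 : ∃ _ : CommGroup (HomotopySphereClass 7),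
      ∀ a b c : HomotopySphereClass 7, HomotopySphereClass.IsMul a b c → a * b = c)
    (hB : HomotopySphere.boundsParallelizable_seven)
    (hC : HomotopySphereClass.isCyclic_bP_four_mul) :
    FourManifolds.exists_commGroup_homotopySphereClass_isCyclic_seven := by
  obtain ⟨inst, hmul⟩ := hA7
  refine ⟨inst, hmul, ?_⟩
  -- (C) with `m = 2`, `n = 7`: `bP₈` is the carrier of a cyclic subgroup `H`.
  obtain ⟨H, hH, hcyc, -⟩ := hC 2 7 (by norm_num) (by norm_num) hmul
  -- (B): `bP₈ = Θ₇`, so `H = ⊤`.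
  have htop : H = ⊤ := by
    rw [← SetLike.coe_set_eq, hH, HomotopySphereClass.bP_seven_eq_univ hB, Subgroup.coe_top]
  subst htop
  exact isCyclic_of_surjective (Subgroup.topEquiv : (⊤ : Subgroup (HomotopySphereClass 7)) ≃* _)
    Subgroup.topEquiv.surjective

/-- **`Θ₇` is cyclic from fifteen named facts at the level of the printed statements.** As
`SPC4.exists_commGroup_homotopySphereClass_isCyclic_seven_of_leaves'`, with Kervaire–Milnor's
Thm. 1.1 replaced by what it rests on in dimension `7`: the class-level group laws
`HomotopySphereClass.GroupLawFacts 7`, reduced in the tree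
(`HomotopySphereClass.groupLawFacts_of_remainingFacts`, `HomotopySpheresGroupAssembly.lean`;
Kervaire–Milnor §2, pp. 505–507) to (iii) sums of homotopy spheres are homotopy spheres
(`HomotopySphere.nonempty_homotopyEquiv_sphere_of_isConnectedSum`, p. 505 — used a second time for
the products in `Θₖ`), (iv) Palais–Cerf uniqueness of oriented connected sums, here of homotopy
`7`-spheres (`exists_diffeomorph_isOrientationPreserving_of_isOrientedConnectedSum`, Lemma 2.1),
(v) associativity (`isOrientedConnectedSum_assoc`, Lemma 2.1), (vii) `Σ # (-Σ) ∼ₕ Sⁿ`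
(`HomotopySphere.isHCobordant_sphere_of_isOrientedConnectedSum_neg`, Lemmas 2.3–2.4) and (viii) the
smooth h-cobordism theorem (`SPC4.nonempty_diffeomorph_of_isHCobordant_of_five_le`, Smale; p. 505),
the group structure then being pure algebra (`HomotopySphereClass.GroupLawFacts.exists_commGroup`,
proof of Thm. 1.1 p. 507, proved; an orientation of `𝕊⁷` exists by `isOrientable_sphere_holds`).
Then, as before: for Thm. 3.1 at `n = 7`, `o₇` is the only obstruction (p. 508) and
`π₆(SO(8)) = 0` (Bott); for §4 at `n = 7`, Lemma 3.3, Lemma 4.2 and `0 ∈ p(Σ⁷)` (Lemma 4.5,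
`coker J₇ = 0`); for Cor. 7.6, Lemma 7.4, Thm. 7.5, §2-additivity of `σ` and the two Lemma 3.4
comparisons. Everything else — existence of oriented connected sums and `M # Sⁿ = M`, the group
structure on classes, Whitney's embedding and tubular neighbourhoods, the Pontryagin–Thom collapse,
the clutching construction, `bP₈ = Θ₇` bookkeeping, the "evident" proof of Cor. 7.6 and the
`ℤ`-orientation of `ℝᵏ` — is proved in the tree. The smooth Poincaré conjecture in dimensions
`≤ 3`, an input of Thm. 1.1 for `Θₙ`, `n ≤ 3`, is not needed for `Θ₇`. [cite: KervaireMilnorAnnals1963, Thm. 1.1 (proof p. 507), §2 (pp. 505–507), Thm. 3.1 (p. 508), Lemma 3.3 (p. 509), §4 (pp. 510–512), Lemma 7.4, Thm. 7.5, Cor. 7.6 (p. 530)] [cite: Bott1959, Theorem (π₆(O) = 0)] -/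
theorem exists_commGroup_homotopySphereClass_isCyclic_seven_of_manifoldFacts
    (hK1 : HomotopySphere.nonempty_homotopyEquiv_sphere_of_isConnectedSum)
    (hPC : ∀ S T U U' : HomotopySphere 7,
      exists_diffeomorph_isOrientationPreserving_of_isOrientedConnectedSum (IM := 𝓡 7)
        (IN := 𝓡 7) (IP := 𝓡 7) (IP' := 𝓡 7) (M := S.carrier) (N := T.carrier)
        (P := U.carrier) (P' := U'.carrier))
    (hK2 : isOrientedConnectedSum_assoc.{0})
    (hK4 : HomotopySphere.isHCobordant_sphere_of_isOrientedConnectedSum_neg)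
    (hS15 : FourManifolds.nonempty_diffeomorph_of_isHCobordant_of_five_le.{0})
    (hAP : HomotopySphere.hasStableTangentFramingAlong_compl_singleton)
    (hBott : Bott1959_sphereMapsToStableFramesExtend_six)
    (h33 : exists_isNormalFraming_of_isStablyParallelizable)
    (h42 : boundsParallelizable_of_collapseNullHomotopic)
    (hc : HomotopySphere.exists_collapseNullHomotopic_seven)
    (h74 : HomotopySphere.exists_mem_signatureSet_sphere_ne_zero)
    (h75 : HomotopySphere.mk_eq_mk_iff_sigmaGen_dvd_sub)
    (hadd : HomotopySphere.add_mem_signatureSet_of_isOrientedConnectedSum)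
    (hne : HomotopySphere.nonempty_signatureSet_of_boundsParallelizable)
    (hbd : HomotopySphere.boundsParallelizable_of_mem_signatureSet) :
    FourManifolds.exists_commGroup_homotopySphereClass_isCyclic_seven := by
  -- Thm. 1.1 in dimension 7: the group laws from the five remaining facts, then pure algebra
  have h7 : HomotopySphereClass.GroupLawFacts 7 :=
    HomotopySphereClass.groupLawFacts_of_remainingFacts (by norm_num) hK1 hPC hK2 hK4 hS15
  obtain ⟨o₀⟩ := (isOrientable_sphere_holds 7 : Nonempty _)
  obtain ⟨inst, hmul, -, -⟩ := h7.exists_commGroup o₀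
  exact FourManifolds.exists_commGroup_homotopySphereClass_isCyclic_seven_of_commGroup ⟨inst, hmul⟩
    -- (B) `Θ₇ = bP₈`: Thm. 3.1 at `n = 7` by clutching, §4 at `n = 7` by Pontryagin–Thom
    (HomotopySphere.boundsParallelizable_seven_of' hBott hAP
      (HomotopySphere.boundsParallelizable_of_isStablyParallelizable_seven_of' h33 h42 hc))
    -- (C) Cor. 7.6 by its evident proof, with the two shared inputs discharged
    (HomotopySphereClass.isCyclic_bP_four_mul_of h74 h75 hadd hne hbd
      (HomotopySphereClass.isMul_exists_of_nonempty_homotopyEquiv_sphere hK1)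
      isOrientableOver_int_euclideanSpace)

end Literature.Topology.FourManifolds
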